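import Summits.ResolutionOfSingularities.ResolutionOfSingularities.Theorems.PAlterationPialtProjective
import Literature.AlgebraicGeometry.Resolution.AlterationsNormalizationReduction
import HarnessLib

/-!
# `Pialt` (crux stmt-ResolutionOfSingularities-0555): reduction to normal proper varieties

Companion to `PAlterationPialtProjective.lean` (`pialt_iff_forall_isProjectiveOver`: Chow's lemma
and projective closure) and `PAlterationPialtReductions.lean` (`pialt_iff_forall_normal`:
normalise first), landed `--supports stmt-ResolutionOfSingularities-0555` (does not close the item).
The two reductions combine: **`Pialt` is equivalent to its restriction to NORMAL integral schemes
PROPER over the field** — for a projective `X'`, its normalisation `X'^ν → X'` is finite (E. Noether),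
so `X'^ν` is normal, integral and proper over `k`, and the conclusion of `Pialt` descends along the
purely inseparable alteration `X'^ν → X'` (`pialtConclusion_of_isPurelyInseparableAlteration`,
`isPurelyInseparableAlteration_normalizationι`); then `pialtConclusion_of_forall_isProjectiveOver`.
Properness is what valuation-theoretic lines use (every valuation of `K(X)/k` has a centre on a
proper `X`), normality what Frobenius/radicial-cover lines use (`PAlterationPialtRadicialCover`).
So a counterexample to `Pialt`, if any, may be taken normal AND proper (and of dimension `≥ 4`).

Sources: A. J. de Jong, Publ. Math. IHÉS 83 (1996), 4.6–4.7; Stacks Project, Tags 02O2, 035Q.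
-/

noncomputable section

set_option linter.dupNamespace false -- mandated namespace of this single-conjunct summit

namespace Summit.ResolutionOfSingularities.ResolutionOfSingularities.Theorems

open CategoryTheory AlgebraicGeometry TopologicalSpace
open Literature.AlgebraicGeometry.Resolution
open Summit.ResolutionOfSingularities.ResolutionOfSingularities.Theses.PAlteration (Pialt)

/-- **The conclusion of `Pialt` for one variety follows from `Pialt` for normal proper varieties
over the same field**: reduce to projective `X'` (`pialtConclusion_of_forall_isProjectiveOver`),
then to the normalisation `X'^ν` of `X'`, which is normal (`isIntegrallyClosed_stalk_normalization`),
integral, and proper over `k` (finite over the proper `X'`), and descend along `X'^ν → X'`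
(`isPurelyInseparableAlteration_normalizationι`). [cite: DeJong1996, 4.6–4.7] -/
theorem pialtConclusion_of_forall_normal_proper {k : Type} [Field k] {X : Scheme.{0}}
    (f : X ⟶ Spec (.of k)) [IsSeparated f] [LocallyOfFiniteType f] [QuasiCompact f] [IsIntegral X]
    (H : ∀ (X' : Scheme.{0}) (f' : X' ⟶ Spec (.of k)), IsProper f' → IsIntegral X' →
      (∀ x : X', IsIntegrallyClosed (X'.presheaf.stalk x)) →
        ∃ (Y : Scheme.{0}) (g : Y ⟶ X'), IsProper g ∧ IsIntegral Y ∧ Scheme.IsRegular Y ∧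
          Function.Surjective g.base ∧ ∃ U : X'.Opens, Dense (U : Set X') ∧ IsFinite (g ∣_ U) ∧
            UniversallyInjective (g ∣_ U)) :
    ∃ (Y : Scheme.{0}) (g : Y ⟶ X), IsProper g ∧ IsIntegral Y ∧ Scheme.IsRegular Y ∧
      Function.Surjective g.base ∧ ∃ U : X.Opens, Dense (U : Set X) ∧ IsFinite (g ∣_ U) ∧
        UniversallyInjective (g ∣_ U) := by
  refine pialtConclusion_of_forall_isProjectiveOver f fun X' f' hi' hproj => ?_
  haveI := hi'
  haveI : IsProper f' := isProper_of_isProjectiveOver f' hproj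
  haveI : IsFinite (normalizationι X') :=
    isFinite_normalizationι X' NoetherFiniteIntegralClosure_holds f'
  refine pialtConclusion_of_isPurelyInseparableAlteration
    (isPurelyInseparableAlteration_normalizationι X' f') ?_
  exact H (normalization X') (normalizationι X' ≫ f') inferInstance inferInstance
    (isIntegrallyClosed_stalk_normalization X')

/-- **Reduction of `Pialt` to normal proper varieties**: `Pialt` holds if and only if, for every
prime `p`, every field `k` of characteristic `p` and every NORMAL integral `k`-scheme `X` PROPER over
`k`, there is a proper surjective `g : X' → X` with `X'` integral regular, finite and universally
injective over a dense open of `X` (Chow's lemma + projective closure + normalisation: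
`pialtConclusion_of_forall_normal_proper`). [cite: DeJong1996, 4.6–4.7] -/
theorem pialt_iff_forall_normal_proper :
    Pialt ↔ ∀ p : ℕ, p.Prime → ∀ (k : Type) [Field k] [CharP k p] (X : Scheme.{0})
      (f : X ⟶ Spec (.of k)), IsProper f → IsIntegral X →
        (∀ x : X, IsIntegrallyClosed (X.presheaf.stalk x)) →
          ∃ (X' : Scheme.{0}) (g : X' ⟶ X), IsProper g ∧ IsIntegral X' ∧ Scheme.IsRegular X' ∧
            Function.Surjective g.base ∧ ∃ U : X.Opens, Dense (U : Set X) ∧ IsFinite (g ∣_ U) ∧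
              UniversallyInjective (g ∣_ U) := by
  refine ⟨fun h p hp k _ _ X f hf hi _ => ?_, fun h => ?_⟩
  · unfold Pialt at h
    haveI := hf
    exact h p hp k X f inferInstance inferInstance inferInstance hi
  · unfold Pialt
    intro p hp k _ _ X f hs hl hq hi
    haveI := hs; haveI := hl; haveI := hq; haveI := hi
    exact pialtConclusion_of_forall_normal_proper f fun X' f' hf' hi' hN' => h p hp k X' f' hf' hi' hN'

end Summit.ResolutionOfSingularities.ResolutionOfSingularities.Theorems

end
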